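import Summits.SmoothPoincare4.SmoothPoincare4.Theorems.SymplecticOrigamiGromovRecognitionRelEndStubEndDoesNotReturn

/-!
# The shared S-stub "the end does not return", in the clothes of the two sibling lines
(crux `GromovRecognitionRelEnd`, item stmt-SmoothPoincare4-11009; lead prover file)

The landed `stub_endDoesNotReturn` of line `cross-cap-laurent`
(`Theorems/SymplecticOrigamiGromovRecognitionRelEndStubEndDoesNotReturn.lean`) is, up to set algebra,
the panel's COMMON FINDING shared by every line on this crux (triage r1-2; Disproof `resists`
bullet 1). This file records the two sibling phrasings as one-line corollaries, so that a re-line of the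
crux on `hopf-planes-no-cap` (`stub_endProper`: conclusion `IsOpen (K ∪ {x | ‖ψ x‖ < ρ})`, extra
hypothesis H4) or on `divisor-stabiliser-surgery` (`stub_endNoReturn`: `x ∉ K` for `x ∈ Kᶜ`, extra
H4) starts with its Stub 1 closed: `K ∪ {x | x ∈ Kᶜ ∧ ‖ψ x‖ < ρ} = K ∪ {x | ‖ψ x‖ < ρ}`.
The statements below are VERBATIM those registered-then-archived stubs (skeletons
`Cruxes/GromovRecognitionRelEnd/Lines/hopf_planes_no_cap.lean` l.130 and
`…/divisor_stabiliser_surgery.lean` l.168), registered again as helper sub-goals of the item.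
-/

noncomputable section

-- the prescribed namespace `Summit.<P>.<Sub>.…` duplicates `SmoothPoincare4` (P = Sub)
set_option linter.dupNamespace false

open scoped Manifold ContDiff Topology
open Set TopologicalSpace Literature.Geometry.Kaehler Literature.Geometry.Symplectic

namespace Summit.SmoothPoincare4.SmoothPoincare4.Theorems.GromovRecognitionRelEnd.CrossCapLaurent

/-- Set algebra: `K ∪ {x | x ∈ Kᶜ ∧ p x} = K ∪ {x | p x}`. [folklore] -/
theorem union_setOf_compl_and {α : Type*} (K : Set α) (p : α → Prop) :
    K ∪ {x | x ∈ Kᶜ ∧ p x} = K ∪ {x | p x} := by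
  ext x
  by_cases hx : x ∈ K <;> simp [hx]

/-- **Registered helper `helper_endProper_hopfLine`** = `stub_endProper` of line `hopf-planes-no-cap`
VERBATIM: under H2, H4–H10 of the crux the sub-level `K ∪ {‖ψ‖ < ρ}` is open for every `ρ > R`.
One line from `stub_endDoesNotReturn` (H4 is not needed). [folklore] -/
theorem helper_endProper_hopfLine :
    ∀ (M : Type) [TopologicalSpace M] [T2Space M] [SecondCountableTopology M]
      [ChartedSpace (EuclideanSpace ℝ (Fin 4)) M] [IsManifold (𝓡 4) ∞ M]
      (sf : MForm (𝓡 4) M ℝ 2) (K : Set M) (R : ℝ) (ψ : M → EuclideanSpace ℝ (Fin 4))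
      (χ : EuclideanSpace ℝ (Fin 4) → M),
      IsSmoothForm sf →
      (∀ x (v : TangentSpace (𝓡 4) x), v ≠ 0 → ∃ w, sf x ![v, w] ≠ 0) →
      (∀ R', R ≤ R' → IsCompact (K ∪ {x | ‖ψ x‖ ≤ R'})) →
      ContMDiffOn (𝓡 4) 𝓘(ℝ, EuclideanSpace ℝ (Fin 4)) ∞ ψ Kᶜ →
      ContMDiffOn 𝓘(ℝ, EuclideanSpace ℝ (Fin 4)) (𝓡 4) ∞ χ
        (Metric.closedBall (0 : EuclideanSpace ℝ (Fin 4)) R)ᶜ →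
      Set.BijOn ψ Kᶜ (Metric.closedBall (0 : EuclideanSpace ℝ (Fin 4)) R)ᶜ →
      (∀ x, x ∈ Kᶜ → χ (ψ x) = x) →
      (∀ x, x ∈ Kᶜ → ∀ v w, sf x ![v, w] =
        stdSymplecticForm (mfderiv (𝓡 4) 𝓘(ℝ, EuclideanSpace ℝ (Fin 4)) ψ x v)
          (mfderiv (𝓡 4) 𝓘(ℝ, EuclideanSpace ℝ (Fin 4)) ψ x w)) →
      ∀ ρ : ℝ, R < ρ → IsOpen (K ∪ {x | ‖ψ x‖ < ρ}) := by
  intro M _ _ _ _ _ sf K R ψ χ h2 _h4 h5 h6 h7 h8 h9 h10 ρ hρ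
  rw [← union_setOf_compl_and K fun x => ‖ψ x‖ < ρ]
  exact stub_endDoesNotReturn M sf K R ψ χ h2 h5 h6 h7 h8 h9 h10 ρ hρ

/-- **Registered helper `helper_endNoReturn_divisorLine`** = `stub_endNoReturn` of line
`divisor-stabiliser-surgery` VERBATIM: under H2, H4–H10, `K ∪ {x | x ∉ K ∧ ‖ψ x‖ < R'}` is open for
every `R' > R`. Definitionally `stub_endDoesNotReturn` (H4 unused). [folklore] -/
theorem helper_endNoReturn_divisorLine :
    ∀ (M : Type) [TopologicalSpace M] [T2Space M] [SecondCountableTopology M]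
      [ChartedSpace (EuclideanSpace ℝ (Fin 4)) M] [IsManifold (𝓡 4) ∞ M]
      (sf : MForm (𝓡 4) M ℝ 2) (K : Set M) (R : ℝ) (ψ : M → EuclideanSpace ℝ (Fin 4))
      (χ : EuclideanSpace ℝ (Fin 4) → M),
      IsSmoothForm sf →
      (∀ x (v : TangentSpace (𝓡 4) x), v ≠ 0 → ∃ w, sf x ![v, w] ≠ 0) →
      (∀ R', R ≤ R' → IsCompact (K ∪ {x | ‖ψ x‖ ≤ R'})) →
      ContMDiffOn (𝓡 4) 𝓘(ℝ, EuclideanSpace ℝ (Fin 4)) ∞ ψ Kᶜ →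
      ContMDiffOn 𝓘(ℝ, EuclideanSpace ℝ (Fin 4)) (𝓡 4) ∞ χ
        (Metric.closedBall (0 : EuclideanSpace ℝ (Fin 4)) R)ᶜ →
      Set.BijOn ψ Kᶜ (Metric.closedBall (0 : EuclideanSpace ℝ (Fin 4)) R)ᶜ →
      (∀ x, x ∈ Kᶜ → χ (ψ x) = x) →
      (∀ x, x ∈ Kᶜ → ∀ v w, sf x ![v, w] =
        stdSymplecticForm (mfderiv (𝓡 4) 𝓘(ℝ, EuclideanSpace ℝ (Fin 4)) ψ x v)
          (mfderiv (𝓡 4) 𝓘(ℝ, EuclideanSpace ℝ (Fin 4)) ψ x w)) →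
      ∀ R', R < R' → IsOpen (K ∪ {x | x ∉ K ∧ ‖ψ x‖ < R'}) := by
  intro M _ _ _ _ _ sf K R ψ χ h2 _h4 h5 h6 h7 h8 h9 h10 R' hR'
  exact stub_endDoesNotReturn M sf K R ψ χ h2 h5 h6 h7 h8 h9 h10 R' hR'

end Summit.SmoothPoincare4.SmoothPoincare4.Theorems.GromovRecognitionRelEnd.CrossCapLaurent

end
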